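import Summits.QuantumFields.YangMills.Theorems.UnitScaleGibbsActionDerivativeSlotDerivatives
import HarnessLib

/-!
# The slot calculus of the Wilson plaquette word in the RIGHT chart `U_b ↦ U_b·e^{t u_b}` (Node00's `expChart U (t•u)`):
# right insertions, the right action derivative `X^R_u`, its one-bond rows, and the summed right Hessian — (SD-R)(ii)

Crux of record `UnitScaleTilt.HistoryTailL` (stmt-QuantumFields-19936) ∕ LINE 28 «GrossTransfer» (skeleton v2 registered on stmt-QuantumFields-23083), cell `ym3-torus`
(YM ladder rung R3 = continuum SU(2) Yang–Mills on T³ — a RUNG, NOT the Clay problem); width seat `ym3-torus-px17` gen 7.  The RIGHT-SHIFT twin of this seat's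
✓ `UnitScaleGibbsActionDerivativeSlotCalculus` ∕ ✓ `…SlotDerivatives` (left shifts `e^{tu_b}·U_b`), asked for as (SD-R)(ii) by px8 g9 (who types (SD-R)(i), the right-shift
one-bond Schwinger–Dyson identity `U ↦ U[b ↦ U_b·k U t]`): CONSTRUCTION C3's natural shift is the right one (`U_b ↦ U_b·e^{t·Ad(g_{y_b}⁻¹)u⁰_b}` moves the axial representative
by `Node00.expChart V (t•u⁰)` exactly, the currency of px10 g7's ✓ `UnitScaleGibbsOnEventHessianAxialGauge`).  Same matrix model `ρ : G →* M_N(ℂ)`, `ρ(k b t) = exp(t u_b)`;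
the slots `slot ρ U p`, words `word`, bonds `slotBond` and the product rule `hasDerivAt_word` are REUSED from the left file.

RIGHT INSERTIONS.  Under `U_e ↦ U_e·k(t)` a direct slot `ρU_e` moves as `ρU_e·e^{tu_e}` (derivative `ρU_e·u_e`), an inverse slot `ρ(U_e⁻¹)` as `e^{−tu_e}·ρ(U_e⁻¹)` (derivative
`(−u_e)·ρ(U_e⁻¹)`): `slotInsR = (ρU₀·u₀, ρU₁·u₁, (−u₂)·ρU₂⁻¹, (−u₃)·ρU₃⁻¹)`, second insertions `slotIns₂R = (ρU₀·u₀·u₀, …, (−u₂)·((−u₂)·ρU₂⁻¹), …)`.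

WHAT IS HERE (ns `…Theorems.UnitScaleGibbsActionDerivativeSlotCalculusRight`; DEFINITIONS `slotInsR slotIns₂R word₂R actionDerivR oneBondDerivR actionDeriv₂R oneBondDeriv₂R`
+ the slot-level theorems; 0 `sorry`): `hasDerivAt_factor_right` ∕ `hasDerivAt_factor_inv_right` (one bond), `hasDerivAt_slot_oneBond_right`, `hasDerivAt_slotInsR_oneBond_right`,
`hasDerivAt_factor_flow_right` ∕ `hasDerivAt_factor_inv_flow_right` ∕ `hasDerivAt_slot_flow_right` ∕ `hasDerivAt_slotInsR_flow_right` (simultaneous right flow `e ↦ U_e·k e t`).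
The action rows, the sums `Σ_b A′^R_b = X^R_u`, `Σ_b X′^R_b = actionDeriv₂R`, continuity and the `SU(N)` dictionary
`actionDeriv₂R (fundamentalRep (Fin N)) ↑Y U = deriv (deriv (t ↦ A(Node00.expChart U (t•Y)))) 0` are the sequel `UnitScaleGibbsActionDerivativeSlotDerivativesRight`.

HONEST SCOPE.  Finite-dimensional calculus; nothing probabilistic; nothing of the registered stubs of LINE 28, «ShallowFluxSecondMomentL», (Q), K1, `MeanDeviationL`, `HistoryTailL`,
R3, d = 4, a continuum limit or a mass gap is proved; the Yang–Mills mass gap is NOT proved.  `--supports stmt-QuantumFields-19936 --as helper`.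

References: M. Creutz, Quarks, Gluons and Lattices (2022) Ch. 11 [Creutz2022]; T. Bałaban, CMP 98 (1985) 17–51, (1.10)-type right charts as in [Balaban1985RegularSpaces] p.77 via
Node00; L. Gross, CMP 92 (1983) 137–162, proof of Thm 2.2 [GrossCMP1983].
-/

set_option autoImplicit false

noncomputable section

open MeasureTheory Filter Topology NormedSpace
open scoped Matrix.Norms.Frobenius BigOperators
open Literature.MathematicalPhysics.QuantumFieldTheory.Balaban1983to89
open Summit.QuantumFields.YangMills.Cruxes.CurvatureAmnesia.WardDefect.SchwingerDyson (hasDerivAt_exp_coe_smul oneParam_neg oneParam_zero)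
open Summit.QuantumFields.YangMills.Theorems.UnitScaleGibbsActionDerivativeSlotCalculus

namespace Summit.QuantumFields.YangMills.Theorems.UnitScaleGibbsActionDerivativeSlotCalculusRight

section Slots

variable {N : ℕ} {P : Params} {j : ℕ} {G : Type} [GaugeGroup G]
  (ρ : G →* Matrix (Fin N) (Fin N) ℂ) (u : PBond P j → Matrix (Fin N) (Fin N) ℂ)

/-- The RIGHT first insertions: `(ρU₀·u₀, ρU₁·u₁, (−u₂)·ρ(U₂⁻¹), (−u₃)·ρ(U₃⁻¹))`. [cite: Creutz2022, Ch. 11] -/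
def slotInsR (U : GaugeField P j G) (p : Plaq P j) : Fin 4 → Matrix (Fin N) (Fin N) ℂ :=
  ![ρ (U ⟨p.src, p.μ⟩) * u ⟨p.src, p.μ⟩, ρ (U ⟨p.src.shift p.μ, p.ν⟩) * u ⟨p.src.shift p.μ, p.ν⟩,
    (-u ⟨p.src.shift p.ν, p.μ⟩) * ρ ((U ⟨p.src.shift p.ν, p.μ⟩)⁻¹), (-u ⟨p.src, p.ν⟩) * ρ ((U ⟨p.src, p.ν⟩)⁻¹)]

/-- The RIGHT second insertions (same slot twice): `ρU_e·u_e·u_e` resp. `(−u_e)·((−u_e)·ρ(U_e⁻¹))`. [cite: Creutz2022, Ch. 11] -/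
def slotIns₂R (U : GaugeField P j G) (p : Plaq P j) : Fin 4 → Matrix (Fin N) (Fin N) ℂ :=
  ![ρ (U ⟨p.src, p.μ⟩) * u ⟨p.src, p.μ⟩ * u ⟨p.src, p.μ⟩,
    ρ (U ⟨p.src.shift p.μ, p.ν⟩) * u ⟨p.src.shift p.μ, p.ν⟩ * u ⟨p.src.shift p.μ, p.ν⟩,
    (-u ⟨p.src.shift p.ν, p.μ⟩) * ((-u ⟨p.src.shift p.ν, p.μ⟩) * ρ ((U ⟨p.src.shift p.ν, p.μ⟩)⁻¹)),
    (-u ⟨p.src, p.ν⟩) * ((-u ⟨p.src, p.ν⟩) * ρ ((U ⟨p.src, p.ν⟩)⁻¹))]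

/-- The sixteen RIGHT double-insertion words. [cite: Creutz2022, Ch. 11] -/
def word₂R (U : GaugeField P j G) (p : Plaq P j) (i l : Fin 4) : Matrix (Fin N) (Fin N) ℂ :=
  word (Function.update (Function.update (slot ρ U p) i (slotInsR ρ u U p i)) l
    (if l = i then slotIns₂R ρ u U p i else slotInsR ρ u U p l))

/-- **THE RIGHT ACTION DERIVATIVE** `X^R_u(U) = (d∕dt) A(U·e^{tu})∣₀ = Σ_p Σ_{i<4} −Re tr(word(slot[i ↦ slotInsR i])) ∕ N`. [cite: GrossCMP1983, Thm 2.2 (proof)] -/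
def actionDerivR (U : GaugeField P j G) : ℝ :=
  ∑ p : Plaq P j, ∑ i : Fin 4, -((word (Function.update (slot ρ U p) i (slotInsR ρ u U p i))).trace.re / N)

variable [DecidableEq (PBond P j)]

/-- The one-bond piece of `X^R_u` (the right-shift derivative of `A` along `b` alone). [cite: Creutz2022, Ch. 11] -/
def oneBondDerivR (b : PBond P j) (U : GaugeField P j G) : ℝ :=
  ∑ p : Plaq P j, ∑ i : Fin 4,
    if slotBond p i = b then -((word (Function.update (slot ρ U p) i (slotInsR ρ u U p i))).trace.re / N) else 0

/-- **THE SUMMED RIGHT SECOND DERIVATIVE** `actionDeriv₂R = Σ_p Σ_{i,l} −Re tr(word₂R p i l) ∕ N`. [cite: GrossCMP1983, Thm 2.2 (proof)] -/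
def actionDeriv₂R (U : GaugeField P j G) : ℝ :=
  ∑ p : Plaq P j, ∑ i : Fin 4, ∑ l : Fin 4, -((word₂R ρ u U p i l).trace.re / N)

/-- The one-bond piece of `actionDeriv₂R` (the right-shift derivative of `X^R_u` along `b`). [cite: Creutz2022, Ch. 11] -/
def oneBondDeriv₂R (b : PBond P j) (U : GaugeField P j G) : ℝ :=
  ∑ p : Plaq P j, ∑ i : Fin 4, ∑ l : Fin 4,
    if slotBond p l = b then -((word₂R ρ u U p i l).trace.re / N) else 0

variable {ρ u} {k : PBond P j → ℝ → G}

/-- A direct link factor under the one-bond RIGHT shift `U ↦ U[b ↦ U_b·k(t)]`: derivative `ρ(U_b)·X` if `b' = b`, else `0`. [cite: Creutz2022, Ch. 11] -/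
theorem hasDerivAt_factor_right {kb : ℝ → G} {X : Matrix (Fin N) (Fin N) ℂ} (hX : ∀ t, ρ (kb t) = exp ((t : ℂ) • X))
    (b b' : PBond P j) (U : GaugeField P j G) :
    HasDerivAt (fun t : ℝ => ρ (Function.update U b (U b * kb t) b')) (if b' = b then ρ (U b) * X else 0) 0 := by
  by_cases h : b' = b
  · subst h
    simp only [Function.update_self, if_true, map_mul, hX]
    exact (hasDerivAt_exp_coe_smul X).const_mul _
  · simp only [Function.update_of_ne h, h, if_false]
    exact hasDerivAt_const _ _

/-- An inverse link factor under the one-bond RIGHT shift: derivative `(−X)·ρ(U_b⁻¹)` if `b' = b`, else `0`. [cite: Creutz2022, Ch. 11] -/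
theorem hasDerivAt_factor_inv_right {kb : ℝ → G} {X : Matrix (Fin N) (Fin N) ℂ} (hk : ∀ s t, kb (s + t) = kb s * kb t)
    (hX : ∀ t, ρ (kb t) = exp ((t : ℂ) • X)) (b b' : PBond P j) (U : GaugeField P j G) :
    HasDerivAt (fun t : ℝ => ρ ((Function.update U b (U b * kb t) b')⁻¹)) (if b' = b then (-X) * ρ ((U b)⁻¹) else 0) 0 := by
  by_cases h : b' = b
  · subst h
    have hfun : (fun t : ℝ => ρ ((Function.update U b' (U b' * kb t) b')⁻¹)) = fun t : ℝ => exp ((t : ℂ) • (-X)) * ρ ((U b')⁻¹) := by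
      funext t
      rw [Function.update_self, mul_inv_rev, ← oneParam_neg hk, map_mul, hX]
      congr 2
      push_cast
      rw [neg_smul, smul_neg]
    rw [hfun]
    simp only [if_true]
    exact (hasDerivAt_exp_coe_smul (-X)).mul_const _
  · simp only [Function.update_of_ne h, h, if_false]
    exact hasDerivAt_const _ _

/-- One-bond right shift: slot `i` of `p` moves iff its bond is `b`, with derivative the right first insertion. [cite: Creutz2022, Ch. 11] -/
theorem hasDerivAt_slot_oneBond_right (hk : ∀ b s t, k b (s + t) = k b s * k b t) (hkX : ∀ b t, ρ (k b t) = exp ((t : ℂ) • u b))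
    (b : PBond P j) (U : GaugeField P j G) (p : Plaq P j) (i : Fin 4) :
    HasDerivAt (fun t : ℝ => slot ρ (Function.update U b (U b * k b t)) p i)
      (if slotBond p i = b then slotInsR ρ u U p i else 0) 0 := by
  fin_cases i
  · have h := hasDerivAt_factor_right (P := P) (j := j) (ρ := ρ) (kb := k b) (X := u b) (hkX b) b ⟨p.src, p.μ⟩ U
    show HasDerivAt (fun t : ℝ => slot ρ (Function.update U b (U b * k b t)) p 0) (if slotBond p 0 = b then slotInsR ρ u U p 0 else 0) 0
    simp only [slot, slotInsR, slotBond, Matrix.cons_val_zero]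
    by_cases hb : (⟨p.src, p.μ⟩ : PBond P j) = b
    · subst hb; rw [if_pos rfl] at h ⊢; exact h
    · rw [if_neg hb] at h ⊢; exact h
  · have h := hasDerivAt_factor_right (P := P) (j := j) (ρ := ρ) (kb := k b) (X := u b) (hkX b) b ⟨p.src.shift p.μ, p.ν⟩ U
    show HasDerivAt (fun t : ℝ => slot ρ (Function.update U b (U b * k b t)) p 1) (if slotBond p 1 = b then slotInsR ρ u U p 1 else 0) 0
    simp only [slot, slotInsR, slotBond, Matrix.cons_val_one, Matrix.cons_val_zero]
    by_cases hb : (⟨p.src.shift p.μ, p.ν⟩ : PBond P j) = b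
    · subst hb; rw [if_pos rfl] at h ⊢; exact h
    · rw [if_neg hb] at h ⊢; exact h
  · have h := hasDerivAt_factor_inv_right (P := P) (j := j) (ρ := ρ) (kb := k b) (X := u b) (hk b) (hkX b) b ⟨p.src.shift p.ν, p.μ⟩ U
    show HasDerivAt (fun t : ℝ => slot ρ (Function.update U b (U b * k b t)) p 2) (if slotBond p 2 = b then slotInsR ρ u U p 2 else 0) 0
    simp only [slot, slotInsR, slotBond, Matrix.cons_val]
    by_cases hb : (⟨p.src.shift p.ν, p.μ⟩ : PBond P j) = b
    · subst hb; rw [if_pos rfl] at h ⊢; exact h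
    · rw [if_neg hb] at h ⊢; exact h
  · have h := hasDerivAt_factor_inv_right (P := P) (j := j) (ρ := ρ) (kb := k b) (X := u b) (hk b) (hkX b) b ⟨p.src, p.ν⟩ U
    show HasDerivAt (fun t : ℝ => slot ρ (Function.update U b (U b * k b t)) p 3) (if slotBond p 3 = b then slotInsR ρ u U p 3 else 0) 0
    simp only [slot, slotInsR, slotBond, Matrix.cons_val]
    by_cases hb : (⟨p.src, p.ν⟩ : PBond P j) = b
    · subst hb; rw [if_pos rfl] at h ⊢; exact h
    · rw [if_neg hb] at h ⊢; exact h

/-- One-bond right shift of a RIGHT first insertion: derivative the right second insertion. [cite: Creutz2022, Ch. 11] -/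
theorem hasDerivAt_slotInsR_oneBond_right (hk : ∀ b s t, k b (s + t) = k b s * k b t) (hkX : ∀ b t, ρ (k b t) = exp ((t : ℂ) • u b))
    (b : PBond P j) (U : GaugeField P j G) (p : Plaq P j) (i : Fin 4) :
    HasDerivAt (fun t : ℝ => slotInsR ρ u (Function.update U b (U b * k b t)) p i)
      (if slotBond p i = b then slotIns₂R ρ u U p i else 0) 0 := by
  fin_cases i
  · have h : HasDerivAt (fun t : ℝ => ρ (Function.update U b (U b * k b t) ⟨p.src, p.μ⟩) * u ⟨p.src, p.μ⟩)
        ((if (⟨p.src, p.μ⟩ : PBond P j) = b then ρ (U b) * u b else 0) * u ⟨p.src, p.μ⟩) 0 :=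
      (hasDerivAt_factor_right (P := P) (j := j) (ρ := ρ) (kb := k b) (X := u b) (hkX b) b ⟨p.src, p.μ⟩ U).mul_const _
    show HasDerivAt (fun t : ℝ => slotInsR ρ u (Function.update U b (U b * k b t)) p 0) (if slotBond p 0 = b then slotIns₂R ρ u U p 0 else 0) 0
    simp only [slotInsR, slotIns₂R, slotBond, Matrix.cons_val_zero]
    by_cases hb : (⟨p.src, p.μ⟩ : PBond P j) = b
    · subst hb; rw [if_pos rfl] at h ⊢; exact h
    · rw [if_neg hb, zero_mul] at h; rw [if_neg hb]; exact h
  · have h : HasDerivAt (fun t : ℝ => ρ (Function.update U b (U b * k b t) ⟨p.src.shift p.μ, p.ν⟩) * u ⟨p.src.shift p.μ, p.ν⟩)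
        ((if (⟨p.src.shift p.μ, p.ν⟩ : PBond P j) = b then ρ (U b) * u b else 0) * u ⟨p.src.shift p.μ, p.ν⟩) 0 :=
      (hasDerivAt_factor_right (P := P) (j := j) (ρ := ρ) (kb := k b) (X := u b) (hkX b) b ⟨p.src.shift p.μ, p.ν⟩ U).mul_const _
    show HasDerivAt (fun t : ℝ => slotInsR ρ u (Function.update U b (U b * k b t)) p 1) (if slotBond p 1 = b then slotIns₂R ρ u U p 1 else 0) 0
    simp only [slotInsR, slotIns₂R, slotBond, Matrix.cons_val_one, Matrix.cons_val_zero]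
    by_cases hb : (⟨p.src.shift p.μ, p.ν⟩ : PBond P j) = b
    · subst hb; rw [if_pos rfl] at h ⊢; exact h
    · rw [if_neg hb, zero_mul] at h; rw [if_neg hb]; exact h
  · have h : HasDerivAt (fun t : ℝ => (-u ⟨p.src.shift p.ν, p.μ⟩) * ρ ((Function.update U b (U b * k b t) ⟨p.src.shift p.ν, p.μ⟩)⁻¹))
        ((-u ⟨p.src.shift p.ν, p.μ⟩) * (if (⟨p.src.shift p.ν, p.μ⟩ : PBond P j) = b then (-u b) * ρ ((U b)⁻¹) else 0)) 0 :=
      (hasDerivAt_factor_inv_right (P := P) (j := j) (ρ := ρ) (kb := k b) (X := u b) (hk b) (hkX b) b ⟨p.src.shift p.ν, p.μ⟩ U).const_mul _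
    show HasDerivAt (fun t : ℝ => slotInsR ρ u (Function.update U b (U b * k b t)) p 2) (if slotBond p 2 = b then slotIns₂R ρ u U p 2 else 0) 0
    simp only [slotInsR, slotIns₂R, slotBond, Matrix.cons_val]
    by_cases hb : (⟨p.src.shift p.ν, p.μ⟩ : PBond P j) = b
    · subst hb; rw [if_pos rfl] at h ⊢; exact h
    · rw [if_neg hb, mul_zero] at h; rw [if_neg hb]; exact h
  · have h : HasDerivAt (fun t : ℝ => (-u ⟨p.src, p.ν⟩) * ρ ((Function.update U b (U b * k b t) ⟨p.src, p.ν⟩)⁻¹))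
        ((-u ⟨p.src, p.ν⟩) * (if (⟨p.src, p.ν⟩ : PBond P j) = b then (-u b) * ρ ((U b)⁻¹) else 0)) 0 :=
      (hasDerivAt_factor_inv_right (P := P) (j := j) (ρ := ρ) (kb := k b) (X := u b) (hk b) (hkX b) b ⟨p.src, p.ν⟩ U).const_mul _
    show HasDerivAt (fun t : ℝ => slotInsR ρ u (Function.update U b (U b * k b t)) p 3) (if slotBond p 3 = b then slotIns₂R ρ u U p 3 else 0) 0
    simp only [slotInsR, slotIns₂R, slotBond, Matrix.cons_val]
    by_cases hb : (⟨p.src, p.ν⟩ : PBond P j) = b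
    · subst hb; rw [if_pos rfl] at h ⊢; exact h
    · rw [if_neg hb, mul_zero] at h; rw [if_neg hb]; exact h

omit [DecidableEq (PBond P j)] in
/-- A direct link factor along the simultaneous RIGHT flow `U ↦ (e ↦ U_e·k e t)`: derivative `ρ(U_e)·u_e`. [cite: Creutz2022, Ch. 11] -/
theorem hasDerivAt_factor_flow_right (hkX : ∀ b t, ρ (k b t) = exp ((t : ℂ) • u b)) (e : PBond P j) (U : GaugeField P j G) :
    HasDerivAt (fun t : ℝ => ρ (U e * k e t)) (ρ (U e) * u e) 0 := by
  simp only [map_mul, hkX]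
  exact (hasDerivAt_exp_coe_smul (u e)).const_mul _

omit [DecidableEq (PBond P j)] in
/-- An inverse link factor along the simultaneous right flow: derivative `(−u_e)·ρ(U_e⁻¹)`. [cite: Creutz2022, Ch. 11] -/
theorem hasDerivAt_factor_inv_flow_right (hk : ∀ b s t, k b (s + t) = k b s * k b t) (hkX : ∀ b t, ρ (k b t) = exp ((t : ℂ) • u b))
    (e : PBond P j) (U : GaugeField P j G) :
    HasDerivAt (fun t : ℝ => ρ ((U e * k e t)⁻¹)) ((-u e) * ρ ((U e)⁻¹)) 0 := by
  have hfun : (fun t : ℝ => ρ ((U e * k e t)⁻¹)) = fun t : ℝ => exp ((t : ℂ) • (-u e)) * ρ ((U e)⁻¹) := by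
    funext t
    rw [mul_inv_rev, ← oneParam_neg (hk e), map_mul, hkX]
    congr 2
    push_cast
    rw [neg_smul, smul_neg]
  rw [hfun]
  exact (hasDerivAt_exp_coe_smul (-u e)).mul_const _

omit [DecidableEq (PBond P j)] in
/-- Simultaneous right flow: every slot moves, with derivative the right first insertion. [cite: Creutz2022, Ch. 11] -/
theorem hasDerivAt_slot_flow_right (hk : ∀ b s t, k b (s + t) = k b s * k b t) (hkX : ∀ b t, ρ (k b t) = exp ((t : ℂ) • u b))
    (U : GaugeField P j G) (p : Plaq P j) (i : Fin 4) :
    HasDerivAt (fun t : ℝ => slot ρ (fun e => U e * k e t) p i) (slotInsR ρ u U p i) 0 := by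
  fin_cases i
  · show HasDerivAt (fun t : ℝ => slot ρ (fun e => U e * k e t) p 0) (slotInsR ρ u U p 0) 0
    simp only [slot, slotInsR, Matrix.cons_val_zero]
    exact hasDerivAt_factor_flow_right (ρ := ρ) (u := u) hkX ⟨p.src, p.μ⟩ U
  · show HasDerivAt (fun t : ℝ => slot ρ (fun e => U e * k e t) p 1) (slotInsR ρ u U p 1) 0
    simp only [slot, slotInsR, Matrix.cons_val_one, Matrix.cons_val_zero]
    exact hasDerivAt_factor_flow_right (ρ := ρ) (u := u) hkX ⟨p.src.shift p.μ, p.ν⟩ U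
  · show HasDerivAt (fun t : ℝ => slot ρ (fun e => U e * k e t) p 2) (slotInsR ρ u U p 2) 0
    simp only [slot, slotInsR, Matrix.cons_val]
    exact hasDerivAt_factor_inv_flow_right (ρ := ρ) (u := u) hk hkX ⟨p.src.shift p.ν, p.μ⟩ U
  · show HasDerivAt (fun t : ℝ => slot ρ (fun e => U e * k e t) p 3) (slotInsR ρ u U p 3) 0
    simp only [slot, slotInsR, Matrix.cons_val]
    exact hasDerivAt_factor_inv_flow_right (ρ := ρ) (u := u) hk hkX ⟨p.src, p.ν⟩ U

omit [DecidableEq (PBond P j)] in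
/-- Simultaneous right flow: a right first insertion moves with derivative the right second insertion. [cite: Creutz2022, Ch. 11] -/
theorem hasDerivAt_slotInsR_flow_right (hk : ∀ b s t, k b (s + t) = k b s * k b t) (hkX : ∀ b t, ρ (k b t) = exp ((t : ℂ) • u b))
    (U : GaugeField P j G) (p : Plaq P j) (i : Fin 4) :
    HasDerivAt (fun t : ℝ => slotInsR ρ u (fun e => U e * k e t) p i) (slotIns₂R ρ u U p i) 0 := by
  fin_cases i
  · show HasDerivAt (fun t : ℝ => slotInsR ρ u (fun e => U e * k e t) p 0) (slotIns₂R ρ u U p 0) 0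
    simp only [slotInsR, slotIns₂R, Matrix.cons_val_zero]
    exact (hasDerivAt_factor_flow_right (ρ := ρ) (u := u) hkX ⟨p.src, p.μ⟩ U).mul_const _
  · show HasDerivAt (fun t : ℝ => slotInsR ρ u (fun e => U e * k e t) p 1) (slotIns₂R ρ u U p 1) 0
    simp only [slotInsR, slotIns₂R, Matrix.cons_val_one, Matrix.cons_val_zero]
    exact (hasDerivAt_factor_flow_right (ρ := ρ) (u := u) hkX ⟨p.src.shift p.μ, p.ν⟩ U).mul_const _
  · show HasDerivAt (fun t : ℝ => slotInsR ρ u (fun e => U e * k e t) p 2) (slotIns₂R ρ u U p 2) 0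
    simp only [slotInsR, slotIns₂R, Matrix.cons_val]
    exact (hasDerivAt_factor_inv_flow_right (ρ := ρ) (u := u) hk hkX ⟨p.src.shift p.ν, p.μ⟩ U).const_mul _
  · show HasDerivAt (fun t : ℝ => slotInsR ρ u (fun e => U e * k e t) p 3) (slotIns₂R ρ u U p 3) 0
    simp only [slotInsR, slotIns₂R, Matrix.cons_val]
    exact (hasDerivAt_factor_inv_flow_right (ρ := ρ) (u := u) hk hkX ⟨p.src, p.ν⟩ U).const_mul _

/-- The right one-bond shift starts at `U`. [folklore] -/
theorem update_mul_right_zero (hk : ∀ b s t, k b (s + t) = k b s * k b t) (b : PBond P j) (U : GaugeField P j G) :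
    Function.update U b (U b * k b 0) = U := by
  rw [flow_zero hk, mul_one, Function.update_eq_self]

omit [DecidableEq (PBond P j)] in
/-- The simultaneous right flow starts at `U`. [folklore] -/
theorem flow_right_zero (hk : ∀ b s t, k b (s + t) = k b s * k b t) (U : GaugeField P j G) : (fun e => U e * k e 0) = U :=
  funext fun e => by rw [flow_zero hk, mul_one]

end Slots

end Summit.QuantumFields.YangMills.Theorems.UnitScaleGibbsActionDerivativeSlotCalculusRight

end
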